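import Mathlib
import Literature.NumberTheory.LFunctions.DeBruijnHDiv
import Summits.RiemannHypothesis.RiemannHypothesis.Theses.UniversalFactor
import Summits.RiemannHypothesis.RiemannHypothesis.Theorems.UniversalFactorLaguerreLift

/-!
# Sketch — crux-ideate stmt-RiemannHypothesis-2576 (`UniversalFactor.NarrowKernelNoGo`), ideator 1, round 1

First lemmas (statements only, all `def … : Prop`, no `sorry`) and the trivial compositions
`C⁺ → NarrowKernelNoGo` for the three idea cards

* `two-step-laguerre-interlacing`  — `ThreeZerosBracket`, transfer `WindowTransfer`;
* `laguerre-riccati-defect`        — `LaguerreDefect`, transfer `DefectTransfer`;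
* `jensen-log-mean-transport`      — `LocalJensenTransport` / `JensenTransportMean`, transfer `LogMeanTransfer`;

plus the shared observation `rh_for_free` (¬RH already refutes `HasOnlyRealZeros F_a`, by the
route's support item `LaguerreLift`, so every card may assume RH) and the shared elementary
off-axis comparison `OffAxisLorentzian`.
-/

noncomputable section

open Complex Set Filter MeasureTheory
open Literature.NumberTheory.LFunctions

namespace Summit.RiemannHypothesis.RiemannHypothesis.Cruxes.NarrowKernelNoGo.Sketch

open Summit.RiemannHypothesis.RiemannHypothesis.Theses.UniversalFactor

/-- `F_a = deBruijnHDiv (1 + u²/a²)`, the Laplace(a)-smoothed `H_0` (syntactically the integral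
inlined in the route items, `deBruijnHDiv_laplace_eq`). -/
abbrev F (a : ℝ) : ℂ → ℂ := deBruijnHDiv fun u : ℝ => 1 + u ^ 2 / a ^ 2

/-! ## Shared: RH for free -/

/-- If RH fails then `F_a ∉ HasOnlyRealZeros` for every `a > 0` (contrapositive of `LaguerreLift`),
so the crux is equivalent to its RH-conditional version. -/
theorem rh_for_free (hL : LaguerreLift) {a : ℝ} (ha : 0 < a)
    (h : HasOnlyRealZeros (deBruijnH 0) → ¬ HasOnlyRealZeros (F a)) : ¬ HasOnlyRealZeros (F a) :=
  fun hF => h (hL a ha hF) hF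

/-- Hypothesis-free form: `LaguerreLift` is PROVED in the tree
(`Theorems/UniversalFactorLaguerreLift.lean`), so RH may be assumed outright on this crux. -/
theorem rh_for_free' {a : ℝ} (ha : 0 < a)
    (h : HasOnlyRealZeros (deBruijnH 0) → ¬ HasOnlyRealZeros (F a)) : ¬ HasOnlyRealZeros (F a) :=
  rh_for_free Summit.RiemannHypothesis.RiemannHypothesis.Theorems.UniversalFactor.laguerreLift ha h

/-- The crux is equivalent to its RH-conditional version. -/
theorem narrowKernelNoGo_iff_conditional :
    NarrowKernelNoGo ↔
      (HasOnlyRealZeros (deBruijnH 0) → ∀ a : ℝ, 32 ≤ a → ¬ HasOnlyRealZeros (F a)) :=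
  ⟨fun h _ => h, fun h a ha => rh_for_free' (by linarith) fun hRH => h hRH a ha⟩

/-- The crux restated through `F`. -/
theorem narrowKernelNoGo_iff :
    NarrowKernelNoGo ↔ ∀ a : ℝ, 32 ≤ a → ¬ HasOnlyRealZeros (F a) := Iff.rfl

/-! ## Shared: the off-axis Lorentzian comparison (Euler-product region, uniform in `a`) -/

/-- On the horizontal line `Im z = 1 + 2ε` (i.e. `σ = -ε` / `1 + ε` for `ξ`), the Laplace average
sees `H_0(· + iy)` as a single exponential of `x`-frequency `ω(x) = ¼ log(x/4π)` with envelope slope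
`π/8`, up to `O(1/(ε log x))`: `F_a(x+iy)/H_0(x+iy) → a²/(a² + (ω − iπ/8)²)`, uniformly in `a ≥ 32`
(stated here for each fixed `a > π/8`). -/
def OffAxisLorentzian : Prop :=
  ∀ a : ℝ, Real.pi / 8 < a → ∀ ε : ℝ, 0 < ε →
    Tendsto (fun x : ℝ =>
        F a (x + (1 + 2 * ε) * I) / deBruijnH 0 (x + (1 + 2 * ε) * I) *
          (1 + ((Real.log (x / (4 * Real.pi)) / 4 - Real.pi / 8 * I) / a) ^ 2))
      atTop (nhds 1)

/-! ## Card `two-step-laguerre-interlacing` -/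

/-- First lemma. Under `HasOnlyRealZeros F_a` the zeros of `F_a`, of `F_a + F_a'/a` and of
`H_0 = (1 − D/a)(1 + D/a) F_a` alternate, hence any three real zeros of `H_0` bracket a zero of
`F_a`. -/
def ThreeZerosBracket : Prop :=
  ∀ a : ℝ, 0 < a → HasOnlyRealZeros (F a) →
    ∀ x₁ x₂ x₃ : ℝ, x₁ < x₂ → x₂ < x₃ →
      deBruijnH 0 x₁ = 0 → deBruijnH 0 x₂ = 0 → deBruijnH 0 x₃ = 0 →
      ∃ x : ℝ, x ∈ Icc x₁ x₃ ∧ F a x = 0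

/-- The one-step alternation behind it (Laguerre applied to `e^{az} F_a`). -/
def InterlaceStep : Prop :=
  ∀ a : ℝ, 0 < a → HasOnlyRealZeros (F a) →
    HasOnlyRealZeros (fun z => F a z + deriv (F a) z / a) ∧
    ∀ x₁ x₂ : ℝ, x₁ < x₂ → F a x₁ = 0 → F a x₂ = 0 → (∀ x ∈ Ioo x₁ x₂, F a x ≠ 0) →
      ∃! x : ℝ, x ∈ Ioo x₁ x₂ ∧ F a x + deriv (F a) x / a = 0

/-- Transfer `C⁺_A` (purely real-axis): for every `a ≥ 32` there is a closed interval containing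
three zeros of `Ξ` (real zeros of `H_0`) on which `F_a` does not vanish. -/
def WindowTransfer : Prop :=
  ∀ a : ℝ, 32 ≤ a → ∃ x₁ x₂ x₃ : ℝ, x₁ < x₂ ∧ x₂ < x₃ ∧
    deBruijnH 0 x₁ = 0 ∧ deBruijnH 0 x₂ = 0 ∧ deBruijnH 0 x₃ = 0 ∧ ∀ x ∈ Icc x₁ x₃, F a x ≠ 0

/-- `C⁺_A → crux`. -/
theorem narrow_of_window (hB : ThreeZerosBracket) (hW : WindowTransfer) : NarrowKernelNoGo := by
  intro a ha hF
  obtain ⟨x₁, x₂, x₃, h12, h23, h1, h2, h3, hne⟩ := hW a ha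
  obtain ⟨x, hx, hx0⟩ := hB a (by linarith) hF x₁ x₂ x₃ h12 h23 h1 h2 h3
  exact hne x hx hx0

/-! ## Card `laguerre-riccati-defect` -/

/-- The Laguerre expression of `F_a` on the real axis with `F_a'' = a²(F_a − H_0)` substituted
(`deBruijnHDiv_laplace_sub_deriv_deriv`): `L₁(x) = F_a'(x)² − a² F_a(x)² + a² F_a(x) H_0(x)`. -/
def laguerreDefect (a x : ℝ) : ℝ :=
  (deriv (F a) x).re ^ 2 - a ^ 2 * (F a x).re ^ 2 + a ^ 2 * (F a x).re * (deBruijnH 0 x).re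

/-- First lemma. `HasOnlyRealZeros F_a` (⇒ `F_a` Laguerre–Pólya: real entire of order `< 2`
with real zeros) ⇒ `(F_a')² − F_a F_a'' ≥ 0` on `ℝ`, i.e. `laguerreDefect a x ≥ 0` for all real
`x`. In particular `|F_a'| ≥ a |F_a|` at every zero of `Ξ`, and every "flat stretch" of `F_a`
(`|F_a'| < a|F_a|`) is free of zeros of `Ξ`. -/
def LaguerreDefect : Prop :=
  ∀ a : ℝ, 0 < a → HasOnlyRealZeros (F a) → ∀ x : ℝ, 0 ≤ laguerreDefect a x

/-- Transfer `C⁺_D` (one real point): for every `a ≥ 32` the Laguerre expression is negative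
somewhere on the real axis. -/
def DefectTransfer : Prop :=
  ∀ a : ℝ, 32 ≤ a → ∃ x : ℝ, laguerreDefect a x < 0

/-- `C⁺_D → crux`. -/
theorem narrow_of_defect (hD : LaguerreDefect) (hT : DefectTransfer) : NarrowKernelNoGo := by
  intro a ha hF
  obtain ⟨x, hx⟩ := hT a ha
  exact absurd (hD a (by linarith) hF x) (not_le.mpr hx)

/-- The SOS / moment form of the transfer actually aimed at (shifted fourth moments of `ζ`):
a quadratic weight `q = H_0 − λ F_a` with `∫_T^{2T} L₁ q² w < 0` for a positive weight `w`. -/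
def DefectSOS : Prop :=
  ∀ a : ℝ, 32 ≤ a → ∃ (lam T : ℝ) (w : ℝ → ℝ), 0 < T ∧ (∀ x, 0 < w x) ∧ ContinuousOn w (Icc T (2 * T)) ∧
    ContinuousOn (fun x => laguerreDefect a x) (Icc T (2 * T)) ∧
    ∫ x in T..2 * T, laguerreDefect a x * ((deBruijnH 0 x).re - lam * (F a x).re) ^ 2 * w x < 0

/-! ## Card `jensen-log-mean-transport` -/

/-- First lemma (local transport). For `F_a` with only real zeros, moving off the axis gains at
least `½ log 2` per zero within horizontal distance `|y|`:
`log |F_a(x+iy)| ≥ log |F_a(x)| + ½ log 2 · #{ξ ∈ s}` for any finite set `s` of such zeros. -/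
def LocalJensenTransport : Prop :=
  ∀ a : ℝ, 0 < a → HasOnlyRealZeros (F a) →
    ∀ (x y : ℝ) (s : Finset ℝ), F a x ≠ 0 → (∀ ξ ∈ s, F a ξ = 0 ∧ |x - ξ| ≤ |y|) →
      Real.log ‖F a x‖ + s.card * (Real.log 2 / 2) ≤ Real.log ‖F a (x + y * I)‖

/-- Mean transport (the engine): LP for `F_a` plus RH make both `x ↦ log|F_a(x+iy)|` and
`x ↦ log|H_0(x+iy)|` gain exactly `π ρ |y|` in `[T,2T]`-mean (`ρ` = common zero density, equal by
interlacing), so the off-axis deficit `log |F_a/H_0| = −2 log(log T/(4a)) + o(1)` at height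
`1 + 2ε` (`OffAxisLorentzian`) descends to the real axis. -/
def JensenTransportMean : Prop :=
  ∀ a : ℝ, 0 < a → HasOnlyRealZeros (F a) → HasOnlyRealZeros (deBruijnH 0) →
    ∃ C T₀ : ℝ, ∀ T ≥ T₀,
      ∫ x in T..2 * T, (Real.log ‖F a x‖ - Real.log ‖deBruijnH 0 x‖) ≤
        T * (C - 2 * Real.log (Real.log T))

/-- Transfer `C⁺_L` (a log-mean / small-ball lower bound for the Laplace-smoothed `Ξ`, no zero
location): the `[T,2T]`-mean of `log |F_a| − log |H_0|` is eventually `≥ −(2 − δ) log log T`. -/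
def LogMeanTransfer : Prop :=
  ∀ a : ℝ, 32 ≤ a → ∃ δ > 0, ∀ T₀ : ℝ, ∃ T ≥ T₀, 1 < Real.log T ∧
    T * (-(2 - δ) * Real.log (Real.log T)) ≤
      ∫ x in T..2 * T, (Real.log ‖F a x‖ - Real.log ‖deBruijnH 0 x‖)

/-- `C⁺_L → crux` (with RH obtained for free from `LaguerreLift`). -/
theorem narrow_of_logMean (hJ : JensenTransportMean) (hM : LogMeanTransfer) :
    NarrowKernelNoGo := by
  intro a ha hF
  have ha0 : (0 : ℝ) < a := by linarith
  have hRH : HasOnlyRealZeros (deBruijnH 0) :=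
    Summit.RiemannHypothesis.RiemannHypothesis.Theorems.UniversalFactor.laguerreLift a ha0 hF
  obtain ⟨C, T₀, hC⟩ := hJ a ha0 hF hRH
  obtain ⟨δ, hδ, hδ'⟩ := hM a ha
  -- choose T beyond T₀, beyond 1, and with δ log log T > C
  obtain ⟨T, hT, hlogT, hlow⟩ := hδ' (max (max T₀ 1) (Real.exp (Real.exp (C / δ + 1))))
  have hT₀ : T₀ ≤ T := le_trans (le_trans (le_max_left _ _) (le_max_left _ _)) hT
  have hT1 : (1 : ℝ) ≤ T := le_trans (le_trans (le_max_right _ _) (le_max_left _ _)) hT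
  have hTexp : Real.exp (Real.exp (C / δ + 1)) ≤ T := le_trans (le_max_right _ _) hT
  have hTpos : 0 < T := by linarith
  have hup := hC T hT₀
  have key : T * (-(2 - δ) * Real.log (Real.log T)) ≤ T * (C - 2 * Real.log (Real.log T)) :=
    le_trans hlow hup
  have key' : -(2 - δ) * Real.log (Real.log T) ≤ C - 2 * Real.log (Real.log T) :=
    le_of_mul_le_mul_left key hTpos
  have hll : C / δ + 1 ≤ Real.log (Real.log T) := by
    have h1 : Real.exp (C / δ + 1) ≤ Real.log T := by
      rw [← Real.log_exp (Real.exp (C / δ + 1))]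
      exact Real.log_le_log (Real.exp_pos _) hTexp
    have h2 : 0 < Real.exp (C / δ + 1) := Real.exp_pos _
    calc C / δ + 1 = Real.log (Real.exp (C / δ + 1)) := (Real.log_exp _).symm
      _ ≤ Real.log (Real.log T) := Real.log_le_log h2 h1
  -- from key': δ log log T ≤ C, contradiction with hll: δ (C/δ + 1) ≤ δ log log T
  have h3 : δ * Real.log (Real.log T) ≤ C := by nlinarith
  have h4 : δ * (C / δ + 1) ≤ δ * Real.log (Real.log T) := mul_le_mul_of_nonneg_left hll hδ.le
  have h5 : δ * (C / δ + 1) = C + δ := by field_simp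
  linarith

end Summit.RiemannHypothesis.RiemannHypothesis.Cruxes.NarrowKernelNoGo.Sketch

end
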